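import Summits.ABC.ABC.Theorems.RibetTakahashiSplitManyPrimeValuationProductStubFermatInputKnown
import Summits.ABC.ABC.Theorems.RibetTakahashiSplitManyPrimeValuationProductBootstrap
import Summits.ABC.ABC.Theorems.RibetTakahashiSplitManyPrimeFreyOfManyPrime
import Summits.ABC.ABC.Theorems.DefiniteXiXiStrongBoundAllTamExp
import Literature.NumberTheory.DiophantineGeometry.GeneralizedFermatTwoPowerCoefficientFreyProofs
import HarnessLib

/-!
# Route RibetTakahashiSplit — `ManyPrimeValuationProductFrey` (r2F, stmt-ABC-15149): reductions

Helper file (`--supports stmt-ABC-15149`) recording where the support statement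
`Summit.ABC.ABC.Theses.RibetTakahashiSplit.ManyPrimeValuationProductFrey` (r2F: for `E/ℚ`
`ℚ`-isomorphic to a twisted Frey–Hellegouarch curve `freyCurve (d a) (d b)`, `a, b` coprime,
`ab(a+b) ≠ 0`, `d ∣ 2`, with `≥ 4` odd multiplicative primes, `T(E) := ∏_{p ∥ N} ord_p Δ_min ≤
C_ε N^ε`) sits among the route's items, all kernel-checked:

* ABOVE it (§1): the whole-class r2 `ManyPrimeValuationProduct` (landed glue, stmt-ABC-15151), the
  route's crux r3′ `WeightedSzpiroBound` (stmt-ABC-3272), Szpiro's conjecture and the summit `ABC`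
  each imply r2F — so r2F admits no refutation short of `¬ ABC`;
* BELOW it (§2): r2F implies the route's many-prime crux R2 `ManyPrimeValuationProductSemistableFrey`
  (stmt-ABC-15174; drop `p ≠ 2`);
* THE EXACT GAP between the crux R2 and r2F (§3, the content of this file):
  `R2 ∧ Residual → r2F` and `r2F ↔ R2 ∧ Residual`, where `Residual` is r2F restricted to curves
  ADDITIVE at `2` (`4 ∣ N`) whose Frey witness has `16 ∤ ab(a+b)` — the Frey curves of abc triples
  with `v₂(abc) ≤ 3`. The point: a curve of the r2F class that is additive at `2` but whose
  witness has `16 ∣ ab(a+b)` (a "wrong" twist by `±1, ±2` of a semistable Frey curve) is handled by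
  R2 applied to the Frey curve `E' = freyCurve A B` of Serre's arrangement `(A, B)`
  (`A ≡ −1 (mod 4)`, `16 ∣ B`, `|AB(A+B)| = |ab(a+b)|`, `exists_arrangement`) of the same triple:
  `E'` is semistable (`N' ∣ rad(ab(a+b))`), at every ODD prime `p` both curves have
  `f_p = [p ∣ ab(a+b)]` and `ord_p Δ_min = 2 v_p(ab(a+b))`
  (`ManyPrimeValuationProduct.factorization_conductorNorm_freyCurve_twist`,
  `…factorization_minimalDiscriminantNorm_freyCurve_twist`), so the odd multiplicative primes of `E`
  are multiplicative primes of `E'` with the same exponents, whence `T(E) ≤ T(E')` (the factor at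
  `2` is absent from `T(E)` as `4 ∣ N`) and `N' ∣ N` (`v₂(N') ≤ 1 < 2 ≤ v₂(N)`), giving
  `T(E) ≤ T(E') ≤ C N'^ε ≤ C N^ε`.

So, as filed, r2F = (crux R2) + (Pasten's Conj. 1.14 on the Frey curves of triples with
`16 ∤ abc`, additive at `2`), the second summand being of the same open-problem grade as R2 itself
(Pasten, arXiv:1705.09251, Conj. 1.14; the planner's route-choice 659892d6 names Pasten's Cor. 10.2
with `S = {2}` as the extra input the line's package would need there).

## References

* H. Pasten, *Shimura curves and the abc conjecture*, J. Number Theory 254 (2024) =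
  arXiv:1705.09251, Conj. 1.14, §16.
* E. Bombieri, W. Gubler, *Heights in Diophantine Geometry*, CUP 2006, Ex. 12.5.10, Thm 12.5.12.
* K. Ribet, *On the equation a^p + 2^α b^p + c^p = 0*, Acta Arith. 79 (1997), §2.
-/

-- `Summit.<Summit>.<Problem>` is the mandated summit-side namespace (CONVENTIONS §2); for the
-- single-conjunct summit `ABC` the two coincide, so the duplicate `ABC.ABC` is deliberate.
set_option linter.dupNamespace false

noncomputable section

namespace Summit.ABC.ABC.Theorems

open WeierstrassCurve UniqueFactorizationMonoid
open Literature.NumberTheory.EllipticCurves Literature.NumberTheory.DiophantineGeometry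
open Summit.ABC.ABC.Theses.RibetTakahashiSplit

/-! ## §1 Truth level: r2F below r2, r3′, Szpiro and `ABC` -/

/-- r2 ⟹ r2F (the landed glue `manyPrimeFreyOfManyPrime_proof`, stmt-ABC-15151, as an
implication between the two route decls). [folklore] -/
theorem manyPrimeValuationProductFrey_of_manyPrimeValuationProduct
    (h : ManyPrimeValuationProduct) : ManyPrimeValuationProductFrey :=
  manyPrimeFreyOfManyPrime_proof h

/-- **r3′ ⟹ r2F**: the route's weighted-Szpiro crux `WeightedSzpiroBound` (stmt-ABC-3272) implies
`ManyPrimeValuationProductFrey` (bootstrap `manyPrimeValuationProduct_of_weightedSzpiroBound`,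
then r2 ⟹ r2F). [folklore] -/
theorem manyPrimeValuationProductFrey_of_weightedSzpiroBound (h : WeightedSzpiroBound) :
    ManyPrimeValuationProductFrey :=
  manyPrimeFreyOfManyPrime_proof (manyPrimeValuationProduct_of_weightedSzpiroBound h)

/-- **Szpiro ⟹ r2F** (de Weger–Hindry direction of Pasten's remark after Conj. 1.14,
arXiv:1705.09251 p. 8, in the route's geometric normalisation; conditional on the OPEN
`Literature.NumberTheory.EllipticCurves.SzpiroConjecture`). [folklore] -/
theorem manyPrimeValuationProductFrey_of_szpiro (h : SzpiroConjecture) :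
    ManyPrimeValuationProductFrey :=
  manyPrimeFreyOfManyPrime_proof (manyPrime_and_fewPrime_of_szpiro h).1

/-- **The summit implies r2F**: `ABC → ManyPrimeValuationProductFrey` (through the discharged
`szpiro_of_abcLe_holds` and the bootstrap); contrapositively a refutation of r2F would refute the
summit, so r2F admits no truth-level refutation short of `¬ ABC`. [folklore] -/
theorem manyPrimeValuationProductFrey_of_abc (h : _root_.ABC) : ManyPrimeValuationProductFrey :=
  manyPrimeFreyOfManyPrime_proof (manyPrimeValuationProduct_of_abc h)

/-! ## §2 r2F ⟹ R2 -/

/-- **r2F ⟹ R2**: `ManyPrimeValuationProductFrey` implies the route's many-prime crux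
`ManyPrimeValuationProductSemistableFrey` (stmt-ABC-15174) — the latter is the former restricted to
semistable curves (forget `p ≠ 2`; same constant). [folklore] -/
theorem manyPrimeValuationProductSemistableFrey_of_frey (h : ManyPrimeValuationProductFrey) :
    ManyPrimeValuationProductSemistableFrey := by
  intro ε hε
  obtain ⟨C, hC⟩ := h ε hε
  exact ⟨C, fun W _ hss hfrey h4 => hC W (fun p hp _ => hss p hp) hfrey h4⟩

/-! ## §3 The gap between R2 and r2F: Frey curves additive at `2` with `16 ∤ ab(a+b)` -/

/-- `4 ∣ A + 1` as a congruence: `A ≡ −1 (mod 4)`. [folklore] -/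
theorem ManyPrimeValuationProductFrey.modEq_neg_one_of_four_dvd {A : ℤ} (hA : 4 ∣ A + 1) :
    A ≡ -1 [ZMOD 4] :=
  Int.modEq_iff_dvd.mpr (by rw [show (-1 : ℤ) - A = -(A + 1) by ring]; exact (dvd_neg).mpr hA)

/-- **R2 ∧ Residual ⟹ r2F.** The support statement `ManyPrimeValuationProductFrey` (r2F,
stmt-ABC-15149) follows from the crux `ManyPrimeValuationProductSemistableFrey` (R2,
stmt-ABC-15174) together with r2F restricted to curves ADDITIVE at `2` (`4 ∣ N`) whose Frey witness
has `16 ∤ ab(a+b)`. Given `W` in the r2F class with witness `C' • W = freyCurve (d a) (d b)`: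
if `4 ∤ N` then `W` is semistable and R2 applies; if `16 ∤ ab(a+b)` (and `4 ∣ N`) the residual
hypothesis applies; otherwise let `(A, B)` be Serre's arrangement of the abc triple
`{|a|, |b|, |a+b|}` (`exists_isABCTriple_of_isCoprime`, `exists_arrangement`: `A ≡ −1 (mod 4)`,
`16 ∣ B`, `|AB(A+B)| = |ab(a+b)|`) and `W' := freyCurve A B`: it is semistable
(`conductorNorm_freyCurve_dvd_radical_of_sixteen_dvd`), in the Frey class (`d = 1`), and at every
odd prime `f_p(W) = f_p(W') = [p ∣ ab(a+b)]`, `ord_p Δ_min(W) = ord_p Δ_min(W') = 2 v_p(ab(a+b))`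
(`ManyPrimeValuationProduct.factorization_conductorNorm_freyCurve_twist`,
`…factorization_minimalDiscriminantNorm_freyCurve_twist`, transported along `C'`); as `4 ∣ N` every
multiplicative prime of `W` is odd, hence a multiplicative prime of `W'` with the same exponent, so
`W'` has `≥ 4` odd multiplicative primes, `T(W) ≤ T(W')`, and `N' ∣ N` (`v₂(N') ≤ 1 < 2 ≤ v₂(N)`):
`T(W) ≤ T(W') ≤ C₁ N'^ε ≤ C N^ε` with `C = max(C₁, C₂, 0)`. [folklore] -/
theorem manyPrimeValuationProductFrey_of_semistableFrey_of_residual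
    (hR2 : ManyPrimeValuationProductSemistableFrey)
    (hres : ∀ ε : ℝ, 0 < ε → ∃ C : ℝ, ∀ (W : WeierstrassCurve ℚ) [W.IsElliptic],
      (∀ p : ℕ, p.Prime → p ≠ 2 → ¬ p ^ 2 ∣ W.conductorNorm ℤ) →
      4 ∣ W.conductorNorm ℤ →
      (∃ (a b d : ℤ) (C' : WeierstrassCurve.VariableChange ℚ), IsCoprime a b ∧
        a * b * (a + b) ≠ 0 ∧ d ∣ 2 ∧ ¬ (16 : ℤ) ∣ a * b * (a + b) ∧
        C' • W = Literature.NumberTheory.EllipticCurves.freyCurve (d * a) (d * b)) →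
      4 ≤ ((W.conductorNorm ℤ).primeFactors.filter
        (fun p => p ≠ 2 ∧ ¬ p ^ 2 ∣ W.conductorNorm ℤ)).card →
      ((∏ p ∈ (W.conductorNorm ℤ).primeFactors with ¬ p ^ 2 ∣ W.conductorNorm ℤ,
        (W.minimalDiscriminantNorm ℤ).factorization p : ℕ) : ℝ) ≤
          C * (W.conductorNorm ℤ : ℝ) ^ ε) :
    ManyPrimeValuationProductFrey := by
  intro ε hε
  obtain ⟨C₁, hC₁⟩ := hR2 ε hε
  obtain ⟨C₂, hC₂⟩ := hres ε hε
  refine ⟨max (max C₁ C₂) 0, ?_⟩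
  intro W _ hss hfrey h4
  have hC₁C : C₁ ≤ max (max C₁ C₂) 0 := (le_max_left _ _).trans (le_max_left _ _)
  have hC₂C : C₂ ≤ max (max C₁ C₂) 0 := (le_max_right _ _).trans (le_max_left _ _)
  have hC0 : (0 : ℝ) ≤ max (max C₁ C₂) 0 := le_max_right _ _
  have hNε : 0 ≤ (W.conductorNorm ℤ : ℝ) ^ ε := by positivity
  by_cases h4N : 4 ∣ W.conductorNorm ℤ
  swap
  · -- `W` is semistable at `2` as well: R2 applies to `W` itself
    have hss' : ∀ p : ℕ, p.Prime → ¬ p ^ 2 ∣ W.conductorNorm ℤ := by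
      intro p hp
      by_cases hp2 : p = 2
      · subst hp2; exact h4N
      · exact hss p hp hp2
    exact (hC₁ W hss' hfrey h4).trans (mul_le_mul_of_nonneg_right hC₁C hNε)
  obtain ⟨a, b, d, C', hab, h0, hd, hW⟩ := hfrey
  by_cases h16 : (16 : ℤ) ∣ a * b * (a + b)
  swap
  · -- the residual class: additive at `2`, `16 ∤ ab(a+b)`
    exact (hC₂ W hss h4N ⟨a, b, d, C', hab, h0, hd, h16, hW⟩ h4).trans
      (mul_le_mul_of_nonneg_right hC₂C hNε)
  -- `16 ∣ ab(a+b)` but `W` is additive at `2`: compare with Serre's arrangement of the same triple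
  set m : ℕ := (a * b * (a + b)).natAbs with hm
  have hm0 : m ≠ 0 := Int.natAbs_ne_zero.mpr h0
  obtain ⟨x, y, z, hxyz, hprod⟩ := exists_isABCTriple_of_isCoprime hab h0
  have h16m : 16 ∣ x * y * z := by
    rw [hprod]; exact Int.natCast_dvd.mp (by exact_mod_cast h16)
  obtain ⟨A, B, hAB, hA, hB, hprodAB, -⟩ := exists_arrangement hxyz h16m
  have hmAB : (A * B * (A + B)).natAbs = m := by rw [hprodAB, hprod]
  have h0' : A * B * (A + B) ≠ 0 := by
    rw [← Int.natAbs_ne_zero, hmAB]; exact hm0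
  have hA' : A ≡ -1 [ZMOD 4] := ManyPrimeValuationProductFrey.modEq_neg_one_of_four_dvd hA
  haveI hE' : (freyCurve A B).IsElliptic := isElliptic_freyCurve h0'
  -- the comparison curve `W' = freyCurve A B`: semistable, in the Frey class
  set N : ℕ := W.conductorNorm ℤ with hNdef
  set N' : ℕ := (freyCurve A B).conductorNorm ℤ with hN'def
  have hN0 : N ≠ 0 := (conductorNorm_pos_holds W).ne'
  have hN'0 : N' ≠ 0 := (conductorNorm_pos_holds (freyCurve A B)).ne'
  have hN'rad : N' ∣ radical m :=
    hmAB ▸ conductorNorm_freyCurve_dvd_radical_of_sixteen_dvd hAB h0' hA' hB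
  have hsq : Squarefree N' := squarefree_radical.squarefree_of_dvd hN'rad
  have hss' : ∀ p : ℕ, p.Prime → ¬ p ^ 2 ∣ N' := fun p hp h =>
    (Nat.squarefree_iff_prime_squarefree.mp hsq) p hp (by simpa [sq] using h)
  have hfrey' : ∃ (a b d : ℤ) (C' : WeierstrassCurve.VariableChange ℚ), IsCoprime a b ∧
      a * b * (a + b) ≠ 0 ∧ d ∣ 2 ∧ C' • freyCurve A B = freyCurve (d * a) (d * b) :=
    ⟨A, B, 1, 1, hAB, h0', one_dvd _, by rw [one_smul, one_mul, one_mul]⟩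
  -- local exponents at the odd primes: the same for `W` and `W'`
  have hNW : N = (freyCurve (d * a) (d * b)).conductorNorm ℤ :=
    ManyPrimeValuationProduct.conductorNorm_eq_of_smul_eq hW
  have hDW : W.minimalDiscriminantNorm ℤ = (freyCurve (d * a) (d * b)).minimalDiscriminantNorm ℤ :=
    ManyPrimeValuationProduct.minimalDiscriminantNorm_eq_of_smul_eq hW
  have hdvd_iff : ∀ p : ℕ, (p : ℤ) ∣ A * B * (A + B) ↔ (p : ℤ) ∣ a * b * (a + b) := by
    intro p; rw [Int.natCast_dvd, Int.natCast_dvd, hmAB]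
  have hfeq : ∀ p : ℕ, p.Prime → p ≠ 2 → N'.factorization p = N.factorization p := by
    intro p hp hp2
    have h₁ := ManyPrimeValuationProduct.factorization_conductorNorm_freyCurve_twist hab h0 hd hp hp2
    have h₂ := ManyPrimeValuationProduct.factorization_conductorNorm_freyCurve_twist hAB h0'
      (one_dvd (2 : ℤ)) hp hp2
    rw [one_mul, one_mul] at h₂
    rw [hNW, h₁, hN'def, h₂]
    by_cases hpm : (p : ℤ) ∣ a * b * (a + b)
    · rw [if_pos hpm, if_pos ((hdvd_iff p).mpr hpm)]
    · rw [if_neg hpm, if_neg (fun h => hpm ((hdvd_iff p).mp h))]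
  have hΔW : ∀ p : ℕ, p.Prime → p ≠ 2 →
      (W.minimalDiscriminantNorm ℤ).factorization p = 2 * m.factorization p := by
    intro p hp hp2
    rw [hDW]
    exact ManyPrimeValuationProduct.factorization_minimalDiscriminantNorm_freyCurve_twist hab h0 hd
      hp hp2
  have hΔW' : ∀ p : ℕ, p.Prime → p ≠ 2 →
      ((freyCurve A B).minimalDiscriminantNorm ℤ).factorization p = 2 * m.factorization p := by
    intro p hp hp2
    have h₂ := ManyPrimeValuationProduct.factorization_minimalDiscriminantNorm_freyCurve_twist hAB h0'
      (one_dvd (2 : ℤ)) hp hp2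
    rw [one_mul, one_mul, hmAB] at h₂
    exact h₂
  -- `N' ∣ N`
  have h2N : 2 ≤ N.factorization 2 :=
    (Nat.prime_two.pow_dvd_iff_le_factorization hN0).mp h4N
  have h2N' : N'.factorization 2 ≤ 1 := by
    by_contra h
    push Not at h
    exact hss' 2 Nat.prime_two ((Nat.prime_two.pow_dvd_iff_le_factorization hN'0).mpr h)
  have hN'N : N' ∣ N := by
    rw [← Nat.factorization_le_iff_dvd hN'0 hN0, Finsupp.le_def]
    intro p
    by_cases hp : p.Prime
    · by_cases hp2 : p = 2
      · subst hp2; omega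
      · rw [hfeq p hp hp2]
    · simp [Nat.factorization_eq_zero_of_not_prime _ hp]
  have hN'leN : (N' : ℝ) ≤ (N : ℝ) := by
    exact_mod_cast Nat.le_of_dvd (Nat.pos_of_ne_zero hN0) hN'N
  -- the multiplicative primes: those of `W` are odd and among those of `W'`
  have hSodd : ∀ p ∈ N.primeFactors.filter (fun p => ¬ p ^ 2 ∣ N), p ≠ 2 := by
    intro p hp h2
    subst h2
    exact (Finset.mem_filter.mp hp).2 h4N
  have hSS' : N.primeFactors.filter (fun p => ¬ p ^ 2 ∣ N) ⊆
      N'.primeFactors.filter (fun p => ¬ p ^ 2 ∣ N') := by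
    intro p hp
    have hp2 := hSodd p hp
    obtain ⟨hpN, -⟩ := Finset.mem_filter.mp hp
    have hpp := Nat.prime_of_mem_primeFactors hpN
    refine Finset.mem_filter.mpr ⟨Nat.mem_primeFactors.mpr ⟨hpp, ?_, hN'0⟩, hss' p hpp⟩
    have h1 : 0 < N.factorization p :=
      hpp.factorization_pos_of_dvd hN0 (Nat.dvd_of_mem_primeFactors hpN)
    exact Nat.dvd_of_factorization_pos (by rw [hfeq p hpp hp2]; exact h1.ne')
  have h4' : 4 ≤ (N'.primeFactors.filter (fun p => p ≠ 2 ∧ ¬ p ^ 2 ∣ N')).card := by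
    refine h4.trans (Finset.card_le_card fun p hp => ?_)
    obtain ⟨hpN, hp2, hpsq⟩ := Finset.mem_filter.mp hp
    obtain ⟨hpN', hpsq'⟩ := Finset.mem_filter.mp (hSS' (Finset.mem_filter.mpr ⟨hpN, hpsq⟩))
    exact Finset.mem_filter.mpr ⟨hpN', hp2, hpsq'⟩
  -- `T(W) ≤ T(W')`
  have hT : ∏ p ∈ N.primeFactors.filter (fun p => ¬ p ^ 2 ∣ N),
        (W.minimalDiscriminantNorm ℤ).factorization p ≤
      ∏ p ∈ N'.primeFactors.filter (fun p => ¬ p ^ 2 ∣ N'),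
        ((freyCurve A B).minimalDiscriminantNorm ℤ).factorization p := by
    calc ∏ p ∈ N.primeFactors.filter (fun p => ¬ p ^ 2 ∣ N),
          (W.minimalDiscriminantNorm ℤ).factorization p
        = ∏ p ∈ N.primeFactors.filter (fun p => ¬ p ^ 2 ∣ N),
            ((freyCurve A B).minimalDiscriminantNorm ℤ).factorization p := by
          refine Finset.prod_congr rfl fun p hp => ?_
          have hp2 := hSodd p hp
          have hpp := Nat.prime_of_mem_primeFactors (Finset.mem_filter.mp hp).1
          rw [hΔW p hpp hp2, hΔW' p hpp hp2]
      _ ≤ ∏ p ∈ N'.primeFactors.filter (fun p => ¬ p ^ 2 ∣ N'),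
            ((freyCurve A B).minimalDiscriminantNorm ℤ).factorization p := by
          refine Finset.prod_le_prod_of_subset_of_one_le' hSS' fun p hp _ => ?_
          have hpN' : p ∈ ((freyCurve A B).minimalDiscriminantNorm ℤ).primeFactors := by
            rw [primeFactors_minimalDiscriminantNorm]; exact (Finset.mem_filter.mp hp).1
          rw [Nat.one_le_iff_ne_zero, ← Finsupp.mem_support_iff, Nat.support_factorization]
          exact hpN'
  -- assemble
  have key := hC₁ (freyCurve A B) hss' hfrey' h4'
  have hN'ε : 0 ≤ (N' : ℝ) ^ ε := by positivity
  calc ((∏ p ∈ N.primeFactors.filter (fun p => ¬ p ^ 2 ∣ N),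
          (W.minimalDiscriminantNorm ℤ).factorization p : ℕ) : ℝ)
      ≤ ((∏ p ∈ N'.primeFactors.filter (fun p => ¬ p ^ 2 ∣ N'),
          ((freyCurve A B).minimalDiscriminantNorm ℤ).factorization p : ℕ) : ℝ) := by
        exact_mod_cast hT
    _ ≤ C₁ * (N' : ℝ) ^ ε := key
    _ ≤ max (max C₁ C₂) 0 * (N' : ℝ) ^ ε := mul_le_mul_of_nonneg_right hC₁C hN'ε
    _ ≤ max (max C₁ C₂) 0 * (N : ℝ) ^ ε :=
        mul_le_mul_of_nonneg_left (Real.rpow_le_rpow (by positivity) hN'leN hε.le) hC0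

/-- **r2F ⟹ Residual** (trivially: forget `4 ∣ N` and `16 ∤ ab(a+b)`; same constant). [folklore] -/
theorem ManyPrimeValuationProductFrey.residual_of_frey (h : ManyPrimeValuationProductFrey) :
    ∀ ε : ℝ, 0 < ε → ∃ C : ℝ, ∀ (W : WeierstrassCurve ℚ) [W.IsElliptic],
      (∀ p : ℕ, p.Prime → p ≠ 2 → ¬ p ^ 2 ∣ W.conductorNorm ℤ) →
      4 ∣ W.conductorNorm ℤ →
      (∃ (a b d : ℤ) (C' : WeierstrassCurve.VariableChange ℚ), IsCoprime a b ∧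
        a * b * (a + b) ≠ 0 ∧ d ∣ 2 ∧ ¬ (16 : ℤ) ∣ a * b * (a + b) ∧
        C' • W = Literature.NumberTheory.EllipticCurves.freyCurve (d * a) (d * b)) →
      4 ≤ ((W.conductorNorm ℤ).primeFactors.filter
        (fun p => p ≠ 2 ∧ ¬ p ^ 2 ∣ W.conductorNorm ℤ)).card →
      ((∏ p ∈ (W.conductorNorm ℤ).primeFactors with ¬ p ^ 2 ∣ W.conductorNorm ℤ,
        (W.minimalDiscriminantNorm ℤ).factorization p : ℕ) : ℝ) ≤
          C * (W.conductorNorm ℤ : ℝ) ^ ε := by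
  intro ε hε
  obtain ⟨C, hC⟩ := h ε hε
  refine ⟨C, fun W _ hss _ hfrey h4 => ?_⟩
  obtain ⟨a, b, d, C', hab, h0, hd, -, hW⟩ := hfrey
  exact hC W hss ⟨a, b, d, C', hab, h0, hd, hW⟩ h4

/-- **r2F ⟺ R2 ∧ Residual.** The support statement `ManyPrimeValuationProductFrey`
(stmt-ABC-15149) is EQUIVALENT to the conjunction of the route's crux
`ManyPrimeValuationProductSemistableFrey` (stmt-ABC-15174) and the residual statement (r2F on the
curves additive at `2` whose Frey witness has `16 ∤ ab(a+b)`): the exact gap between the crux and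
this support item. [folklore] -/
theorem manyPrimeValuationProductFrey_iff_semistableFrey_and_residual :
    ManyPrimeValuationProductFrey ↔
      (ManyPrimeValuationProductSemistableFrey ∧
      ∀ ε : ℝ, 0 < ε → ∃ C : ℝ, ∀ (W : WeierstrassCurve ℚ) [W.IsElliptic],
        (∀ p : ℕ, p.Prime → p ≠ 2 → ¬ p ^ 2 ∣ W.conductorNorm ℤ) →
        4 ∣ W.conductorNorm ℤ →
        (∃ (a b d : ℤ) (C' : WeierstrassCurve.VariableChange ℚ), IsCoprime a b ∧
          a * b * (a + b) ≠ 0 ∧ d ∣ 2 ∧ ¬ (16 : ℤ) ∣ a * b * (a + b) ∧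
          C' • W = Literature.NumberTheory.EllipticCurves.freyCurve (d * a) (d * b)) →
        4 ≤ ((W.conductorNorm ℤ).primeFactors.filter
          (fun p => p ≠ 2 ∧ ¬ p ^ 2 ∣ W.conductorNorm ℤ)).card →
        ((∏ p ∈ (W.conductorNorm ℤ).primeFactors with ¬ p ^ 2 ∣ W.conductorNorm ℤ,
          (W.minimalDiscriminantNorm ℤ).factorization p : ℕ) : ℝ) ≤
            C * (W.conductorNorm ℤ : ℝ) ^ ε) :=
  ⟨fun h => ⟨manyPrimeValuationProductSemistableFrey_of_frey h,
    ManyPrimeValuationProductFrey.residual_of_frey h⟩,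
    fun h => manyPrimeValuationProductFrey_of_semistableFrey_of_residual h.1 h.2⟩

end Summit.ABC.ABC.Theorems

end
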